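import Summits.Ventures.PercRepro.ProfilePointedCircuitClassesStarSharpD
import Summits.Ventures.PercRepro.ProfilePointedCircuitClassesStarSharpAsmC

/-!
# PercRepro — THE CONSEQUENCES OF `StarNineSharp`: (★) WITH TWO SERIES PAIRS AND THE THREE-SERIES-PAIR REGIME OF
THE TWELVE-POINT STATEMENT, UNCONDITIONALLY
(p5, gen 56; `proofs/P5-GM1.md` §84 (f))

The conditional theorems of StarSharpD (g52) with the Prop `StarNineSharp` discharged by `starNineSharp_holds`:
(★) on eleven points with two disjoint series pairs through whose second points no further series pair passes
(`star_of_two_seriesPairs`), and the three-series-pair regime of the twelve-point statement on every coloop-free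
matroid (`inCount_five_le_outCount_six_of_three_seriesPairs_all`).
-/

open scoped Matroid

namespace PercRepro.Cogirth

open Finset ThmH Skew Shadow Profile

variable {α : Type} [DecidableEq α] {N : Matroid α} [N.Finite]

section StarSharpAsmD

/-- **(★) ON ELEVEN POINTS WITH TWO DISJOINT SERIES PAIRS**, unconditionally. -/
theorem star_of_two_seriesPairs (hn : (gr N).card = 11) (hR : rk N (gr N) = 6)
    (hcf : ∀ x ∈ gr N, rk N ((gr N).erase x) = 6) {b b' c c' e f : α}
    (h : SeriesPair N b b') (h' : SeriesPair N c c') (hbc : b ≠ c) (hbc' : b ≠ c') (hb'c : b' ≠ c)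
    (hb'c' : b' ≠ c') (hnob : ∀ x ∈ gr N, x ≠ b → ¬ SeriesPair N b' x)
    (hnoc : ∀ x ∈ gr N, x ≠ c → ¬ SeriesPair N c' x) (he : e ∈ gr N) (hf : f ∈ gr N) (hef : e ≠ f)
    (heb : e ≠ b) (heb' : e ≠ b') (hec : e ≠ c) (hec' : e ≠ c') (hfb : f ≠ b) (hfb' : f ≠ b') (hfc : f ≠ c)
    (hfc' : f ≠ c') : inCount N 5 e ≤ inCount N 5 f + thruCount N 5 {e, f} :=
  star_of_two_seriesPairs_of_starNineSharp starNineSharp_holds hn hR hcf h h' hbc hbc' hb'c hb'c' hnob hnoc he hf hef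
    heb heb' hec hec' hfb hfb' hfc hfc'

/-- **THE THREE-SERIES-PAIR REGIME OF THE TWELVE-POINT STATEMENT**, unconditionally: on every coloop-free matroid
with `#E = 12`, `ρ(E) = 7` and three disjoint series pairs, `in_5(e) ≤ out_6(e)` at every point `e` outside the
pairs. -/
theorem inCount_five_le_outCount_six_of_three_seriesPairs_all (hn : (gr N).card = 12) (hR : rk N (gr N) = 7)
    (hcf : ∀ x ∈ gr N, rk N ((gr N).erase x) = 7)
    {a a' b b' c c' e : α} (h : SeriesPair N a a') (h' : SeriesPair N b b') (h'' : SeriesPair N c c')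
    (hab : a ≠ b) (hab' : a ≠ b') (hac : a ≠ c) (hac' : a ≠ c') (ha'b : a' ≠ b) (ha'b' : a' ≠ b') (ha'c : a' ≠ c)
    (ha'c' : a' ≠ c') (hbc : b ≠ c) (hbc' : b ≠ c') (hb'c : b' ≠ c) (hb'c' : b' ≠ c') (he : e ∈ gr N) (hea : e ≠ a)
    (hea' : e ≠ a') (heb : e ≠ b) (heb' : e ≠ b') (hec : e ≠ c) (hec' : e ≠ c') : inCount N 5 e ≤ outCount N 6 e :=
  inCount_five_le_outCount_six_of_three_seriesPairs_of_starNineSharp_all starNineSharp_holds hn hR hcf h h' h'' hab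
    hab' hac hac' ha'b ha'b' ha'c ha'c' hbc hbc' hb'c hb'c' he hea hea' heb heb' hec hec'

end StarSharpAsmD

end PercRepro.Cogirth
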